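import Summits.QuantumAdvantage.QuantumAdvantage.Theorems.HankelLiftBeyondRectanglesMajThr

/-!
# The `MAJ ∘ PARITY` rung for the lifted Liouville witness `λ(x+y+2)` (unconditional)

Route `route-QuantumAdvantage-HankelLift`; support of its open hypothesis-type crux
`HankelLift.BeyondRectangles` (stmt-QuantumAdvantage-18440), companion of
`Theorems/HankelLiftBeyondRectanglesMajThr.lean`.

* `hankel_signedSeparable_bound` — for every `C`, for all large `n`, every SEPARABLE `±1` test
  `u(x)·v(y)` (`u, v : [2^n] → {±1}`) has `|∑_{x,y} u(x) λ(x+y+2) v(y)| ≤ 4·4^n/n^C` (four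
  rectangles of `HankelDiscrepancy`).  In particular every one of the `4^n` Walsh–Fourier
  coefficients of `(x,y) ↦ λ(x+y+2)` (parities of subsets of the `2n` input bits, which factor as
  `χ_S(x)·χ_T(y)`) is `≤ 4·n^{−C}`: `hankel_walsh_coefficient_bound` (characters written inline as
  `(−1)^{#{k∈S : bit_k(x)=1}}`; no new definitions).
* `liouville_pair_not_majParity` — for every `c`, for all large `n`, NO depth-2 circuit
  `[w₀ ≤ ∑ᵢ wᵢ gᵢ]` with integer top weights `|wᵢ| ≤ n^c` over `s ≤ n^c` PARITY gates
  `gᵢ(x,y) = ⨁_{k∈Sᵢ} x_k ⊕ ⨁_{k∈Tᵢ} y_k` of the input bits computes `[λ(x+y+2) = −1]` on `[2^n]²`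
  (the class `MAJ ∘ PARITY` = small-weight polynomial threshold functions of polynomial sparsity,
  Bruck's `P̂T₁`; discriminator lemma `discriminator_ineq` + the Walsh bound).

Pattern of proof: Jukna 2012 §11.10 (discriminator lemma; Bruck–Smolensky-type `P̂T₁` bounds
from small Fourier coefficients), with the spectral input supplied by Davenport's theorem through
`HankelDiscrepancy`.  Not here: `THR ∘ PARITY` with unbounded top weights (a sign-rank statement,
conditional on Forster's theorem as in `…BeyondRectanglesSignRank.lean`).
-/

set_option linter.dupNamespace false -- D-0017: single-problem summit ⇒ `QuantumAdvantage.QuantumAdvantage` by design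

noncomputable section

namespace Summit.QuantumAdvantage.QuantumAdvantage.Theorems.HankelLift

open Finset Real Filter ArithmeticFunction

/-- **Separable `±1` tests.**  For every `C`, for all large `n`: for all `u, v : [2^n] → {±1}`,
`|∑_x ∑_y u(x)·λ(x+y+2)·v(y)| ≤ 4·4^n/n^C` — split `[2^n]²` into the four rectangles
`{u = ±1} × {v = ±1}` and apply `HankelDiscrepancy` (`hankelDiscrepancy_proof`) to each. [folklore] -/
theorem hankel_signedSeparable_bound (C : ℕ) : ∀ᶠ n : ℕ in atTop, ∀ u v : Fin (2 ^ n) → ℝ,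
    (∀ x, u x = 1 ∨ u x = -1) → (∀ y, v y = 1 ∨ v y = -1) →
      |∑ x : Fin (2 ^ n), ∑ y : Fin (2 ^ n),
          u x * ((liouville (x.val + y.val + 2) : ℤ) : ℝ) * v y| ≤
        4 * ((4 : ℝ) ^ n / (n : ℝ) ^ C) := by
  filter_upwards [hankelDiscrepancy_proof C] with n hn u v hu hv
  classical
  set L : Fin (2 ^ n) → Fin (2 ^ n) → ℝ := fun x y => ((liouville (x.val + y.val + 2) : ℤ) : ℝ)
    with hL
  set Tp : Finset (Fin (2 ^ n)) := Finset.univ.filter fun y => v y = 1 with hTp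
  set Tm : Finset (Fin (2 ^ n)) := Finset.univ.filter fun y => ¬ v y = 1 with hTm
  set Sp : Finset (Fin (2 ^ n)) := Finset.univ.filter fun x => u x = 1 with hSp
  set Sm : Finset (Fin (2 ^ n)) := Finset.univ.filter fun x => ¬ u x = 1 with hSm
  -- inner sums
  have hin : ∀ x, ∑ y, u x * L x y * v y = u x * (∑ y ∈ Tp, L x y - ∑ y ∈ Tm, L x y) := by
    intro x
    rw [← Finset.sum_filter_add_sum_filter_not Finset.univ (fun y => v y = 1), mul_sub,
      Finset.mul_sum, Finset.mul_sum, sub_eq_add_neg, ← Finset.sum_neg_distrib]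
    congr 1
    · refine Finset.sum_congr rfl fun y hy => ?_
      rw [(Finset.mem_filter.mp hy).2, mul_one]
    · refine Finset.sum_congr rfl fun y hy => ?_
      have h := (Finset.mem_filter.mp hy).2
      have h' : v y = -1 := (hv y).resolve_left h
      rw [h']; ring
  have hout : ∑ x, u x * (∑ y ∈ Tp, L x y - ∑ y ∈ Tm, L x y) =
      (∑ x ∈ Sp, ∑ y ∈ Tp, L x y - ∑ x ∈ Sp, ∑ y ∈ Tm, L x y) -
        (∑ x ∈ Sm, ∑ y ∈ Tp, L x y - ∑ x ∈ Sm, ∑ y ∈ Tm, L x y) := by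
    rw [← Finset.sum_filter_add_sum_filter_not Finset.univ (fun x => u x = 1), sub_eq_add_neg,
      ← Finset.sum_sub_distrib, ← Finset.sum_sub_distrib, ← Finset.sum_neg_distrib]
    congr 1
    · refine Finset.sum_congr rfl fun x hx => ?_
      rw [(Finset.mem_filter.mp hx).2, one_mul]
    · refine Finset.sum_congr rfl fun x hx => ?_
      have h := (Finset.mem_filter.mp hx).2
      have h' : u x = -1 := (hu x).resolve_left h
      rw [h']; ring
  rw [Finset.sum_congr rfl fun x _ => hin x, hout]
  have h1 := hn Sp Tp
  have h2 := hn Sp Tm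
  have h3 := hn Sm Tp
  have h4 := hn Sm Tm
  simp only [hL] at h1 h2 h3 h4 ⊢
  have e1 := abs_sub (∑ x ∈ Sp, ∑ y ∈ Tp, L x y - ∑ x ∈ Sp, ∑ y ∈ Tm, L x y)
    (∑ x ∈ Sm, ∑ y ∈ Tp, L x y - ∑ x ∈ Sm, ∑ y ∈ Tm, L x y)
  have e2 := abs_sub (∑ x ∈ Sp, ∑ y ∈ Tp, L x y) (∑ x ∈ Sp, ∑ y ∈ Tm, L x y)
  have e3 := abs_sub (∑ x ∈ Sm, ∑ y ∈ Tp, L x y) (∑ x ∈ Sm, ∑ y ∈ Tm, L x y)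
  simp only [hL] at e1 e2 e3
  linarith

/-- **All Walsh–Fourier coefficients of `λ(x+y+2)` are small.**  For every `C`, for all large `n`,
for all `S, T ⊆ [n]`: `|∑_{x,y} χ_S(x) χ_T(y) λ(x+y+2)| ≤ 4·4^n/n^C`, i.e. the correlation of
`λ(x+y+2)` with the parity of ANY subset of the `2n` input bits is `≤ 4/n^C`
(`hankel_signedSeparable_bound`). [folklore] -/
theorem hankel_walsh_coefficient_bound (C : ℕ) : ∀ᶠ n : ℕ in atTop, ∀ S T : Finset (Fin n),
    |∑ x : Fin (2 ^ n), ∑ y : Fin (2 ^ n),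
        (-1 : ℝ) ^ (S.filter fun k : Fin n => Nat.testBit x.val k).card *
          ((liouville (x.val + y.val + 2) : ℤ) : ℝ) *
          (-1 : ℝ) ^ (T.filter fun k : Fin n => Nat.testBit y.val k).card| ≤
      4 * ((4 : ℝ) ^ n / (n : ℝ) ^ C) := by
  filter_upwards [hankel_signedSeparable_bound C] with n hn S T
  exact hn (fun x => (-1 : ℝ) ^ (S.filter fun k : Fin n => Nat.testBit x.val k).card)
    (fun y => (-1 : ℝ) ^ (T.filter fun k : Fin n => Nat.testBit y.val k).card)
    (fun x => neg_one_pow_eq_or ℝ _) (fun y => neg_one_pow_eq_or ℝ _)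

/-- A parity gate is an affine function of the product character:
`[#S-bits of x + #T-bits of y odd]·F = F·(1 − χ_S(x)χ_T(y))/2`, `χ_S(x) = (−1)^{#S-bits of x}`.
[folklore] -/
theorem ite_odd_eq_mul_char {n : ℕ} (S T : Finset (Fin n)) (x y : Fin (2 ^ n)) (F : ℝ) :
    (if Odd ((S.filter fun k : Fin n => Nat.testBit x.val k).card +
        (T.filter fun k : Fin n => Nat.testBit y.val k).card) then F else 0) =
      F * (1 - (-1 : ℝ) ^ (S.filter fun k : Fin n => Nat.testBit x.val k).card *
        (-1 : ℝ) ^ (T.filter fun k : Fin n => Nat.testBit y.val k).card) / 2 := by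
  rw [← pow_add]
  rcases Nat.even_or_odd ((S.filter fun k : Fin n => Nat.testBit x.val k).card +
      (T.filter fun k : Fin n => Nat.testBit y.val k).card) with h | h
  · rw [if_neg (Nat.not_odd_iff_even.mpr h), h.neg_one_pow]; ring
  · rw [if_pos h, h.neg_one_pow]; ring

/-- **The `MAJ ∘ PARITY` rung (unconditional).**  For every `c`, for all large `n`: for every
`s ≤ n^c`, all subsets `Sᵢ, Tᵢ ⊆ [n]` (parity gates `gᵢ(x,y) = ⨁_{k∈Sᵢ} x_k ⊕ ⨁_{k∈Tᵢ} y_k` of the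
`2n` input bits), all integer top weights `|wᵢ| ≤ n^c` and every integer threshold `w₀`, the
depth-2 circuit `[w₀ ≤ ∑ᵢ wᵢ gᵢ(x,y)]` differs from `[λ(x+y+2) = −1]` at some `(x,y) ∈ [2^n]²`:
the lifted Liouville witness is not a small-weight, polynomially sparse polynomial threshold
function (`P̂T₁`).  Discriminator lemma (`discriminator_ineq`, threshold clipped by
`le_iff_clip_le`) against the Walsh bound: every gate sum is `(∑F − ∑χFψ)/2 ≤ 4·4^n/n^{2c+1}`, so
`4^n ≤ (16n^{2c} + 12)·4^n/n^{2c+1} < 4^n` for `n ≥ 29`.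
[cite: Jukna2012, §11.10 Discriminator Lemma (p. 330)] -/
theorem liouville_pair_not_majParity (c : ℕ) : ∀ᶠ n : ℕ in atTop, ∀ s : ℕ, s ≤ n ^ c →
    ∀ (S T : Fin s → Finset (Fin n)) (w : Fin s → ℤ) (w₀ : ℤ),
      (∀ i, |w i| ≤ (n : ℤ) ^ c) →
      ∃ p : Fin (2 ^ n) × Fin (2 ^ n),
        decide (w₀ ≤ ∑ i, if Odd (((S i).filter fun k : Fin n => Nat.testBit p.1.val k).card +
            ((T i).filter fun k : Fin n => Nat.testBit p.2.val k).card) then w i else 0) ≠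
          decide (liouville (p.1.val + p.2.val + 2) = -1) := by
  filter_upwards [hankel_signedSeparable_bound (2 * c + 1), eventually_ge_atTop 29] with
    n hsep hn29 s hs S T w w₀ hw
  by_contra hall
  push Not at hall
  -- notation
  set F : Fin (2 ^ n) × Fin (2 ^ n) → ℝ := fun p => ((liouville (p.1.val + p.2.val + 2) : ℤ) : ℝ)
    with hFdef
  set δ : ℝ := (4 : ℝ) ^ n / (n : ℝ) ^ (2 * c + 1) with hδdef
  have hF : ∀ p, F p = 1 ∨ F p = -1 := by
    intro p
    simp only [hFdef]
    rw [liouville_apply (by omega)]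
    rcases neg_one_pow_eq_or ℤ (cardFactors (p.1.val + p.2.val + 2)) with h | h <;> simp [h]
  -- the weighted sums are bounded by `W = ∑ |wᵢ|`
  set W : ℤ := ∑ i, |w i| with hWdef
  have hX : ∀ p : Fin (2 ^ n) × Fin (2 ^ n),
      |∑ i, (if Odd (((S i).filter fun k : Fin n => Nat.testBit p.1.val k).card +
        ((T i).filter fun k : Fin n => Nat.testBit p.2.val k).card) then w i else 0)| ≤ W := by
    intro p
    refine (Finset.abs_sum_le_sum_abs _ _).trans (Finset.sum_le_sum fun i _ => ?_)
    split_ifs <;> simp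
  -- clip the threshold
  set w₀' : ℤ := max (-(W + 1)) (min (W + 1) w₀) with hw₀'def
  have hw₀' : |w₀'| ≤ W + 1 := by
    have hW0 : 0 ≤ W := Finset.sum_nonneg fun i _ => abs_nonneg _
    exact abs_le.mpr ⟨le_max_left _ _, max_le (by omega) (min_le_left _ _)⟩
  have hall' : ∀ p : Fin (2 ^ n) × Fin (2 ^ n),
      (w₀' ≤ ∑ i, if Odd (((S i).filter fun k : Fin n => Nat.testBit p.1.val k).card +
        ((T i).filter fun k : Fin n => Nat.testBit p.2.val k).card) then w i else 0) ↔ F p = -1 := by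
    intro p
    have h := hall p
    rw [decide_eq_decide] at h
    refine (le_iff_clip_le (hX p)).symm.trans (h.trans ⟨fun h1 => ?_, fun h1 => ?_⟩)
    · simp [hFdef, h1]
    · simp only [hFdef] at h1
      exact_mod_cast h1
  -- the discriminator inequality
  have hD := discriminator_ineq F hF
    (fun i p => Odd (((S i).filter fun k : Fin n => Nat.testBit p.1.val k).card +
      ((T i).filter fun k : Fin n => Nat.testBit p.2.val k).card)) w w₀' hall'
  -- the gate sums: `(∑ F − ∑ χ F ψ)/2`
  have hconst : |∑ p : Fin (2 ^ n) × Fin (2 ^ n), F p| ≤ 4 * δ := by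
    have h := hsep (fun _ => (1 : ℝ)) (fun _ => 1) (fun _ => Or.inl rfl) (fun _ => Or.inl rfl)
    simp only [one_mul, mul_one] at h
    rwa [Fintype.sum_prod_type]
  have hgate : ∀ i, |∑ p : Fin (2 ^ n) × Fin (2 ^ n),
      (if Odd (((S i).filter fun k : Fin n => Nat.testBit p.1.val k).card +
        ((T i).filter fun k : Fin n => Nat.testBit p.2.val k).card) then F p else 0)| ≤ 4 * δ := by
    intro i
    set χ : Fin (2 ^ n) → ℝ := fun x =>
      (-1 : ℝ) ^ ((S i).filter fun k : Fin n => Nat.testBit x.val k).card with hχ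
    set ψ : Fin (2 ^ n) → ℝ := fun y =>
      (-1 : ℝ) ^ ((T i).filter fun k : Fin n => Nat.testBit y.val k).card with hψ
    have hchar := hsep χ ψ (fun x => neg_one_pow_eq_or ℝ _) (fun y => neg_one_pow_eq_or ℝ _)
    have hrw : ∑ p : Fin (2 ^ n) × Fin (2 ^ n),
        (if Odd (((S i).filter fun k : Fin n => Nat.testBit p.1.val k).card +
          ((T i).filter fun k : Fin n => Nat.testBit p.2.val k).card) then F p else 0) =
        ((∑ p : Fin (2 ^ n) × Fin (2 ^ n), F p) -
          ∑ x : Fin (2 ^ n), ∑ y : Fin (2 ^ n),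
            χ x * ((liouville (x.val + y.val + 2) : ℤ) : ℝ) * ψ y) / 2 := by
      rw [Finset.sum_congr rfl fun p _ => ite_odd_eq_mul_char (S i) (T i) p.1 p.2 (F p),
        Fintype.sum_prod_type, Fintype.sum_prod_type, ← Finset.sum_sub_distrib,
        Finset.sum_div]
      refine Finset.sum_congr rfl fun x _ => ?_
      rw [← Finset.sum_sub_distrib, Finset.sum_div]
      refine Finset.sum_congr rfl fun y _ => ?_
      simp only [hFdef, hχ, hψ]
      ring
    rw [hrw, abs_div, abs_two]
    have e := abs_sub (∑ p : Fin (2 ^ n) × Fin (2 ^ n), F p)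
      (∑ x : Fin (2 ^ n), ∑ y : Fin (2 ^ n),
        χ x * ((liouville (x.val + y.val + 2) : ℤ) : ℝ) * ψ y)
    have hδ0 : 0 ≤ δ := by positivity
    linarith
  -- numerics
  have hcard : (Fintype.card (Fin (2 ^ n) × Fin (2 ^ n)) : ℝ) = (4 : ℝ) ^ n := by
    rw [Fintype.card_prod, Fintype.card_fin]
    push_cast
    rw [← mul_pow]; norm_num
  have hWle : (W : ℝ) ≤ s * (n : ℝ) ^ c := by
    have h : W ≤ ∑ _i : Fin s, (n : ℤ) ^ c := Finset.sum_le_sum fun i _ => hw i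
    rw [Finset.sum_const, Finset.card_univ, Fintype.card_fin, nsmul_eq_mul] at h
    exact_mod_cast h
  have hδ0 : 0 ≤ δ := by positivity
  have hT1 : ∑ i, |(w i : ℝ)| * |∑ p : Fin (2 ^ n) × Fin (2 ^ n),
      (if Odd (((S i).filter fun k : Fin n => Nat.testBit p.1.val k).card +
        ((T i).filter fun k : Fin n => Nat.testBit p.2.val k).card) then F p else 0)| ≤
      s * (n : ℝ) ^ c * (4 * δ) := by
    calc ∑ i, |(w i : ℝ)| * |∑ p : Fin (2 ^ n) × Fin (2 ^ n),
          (if Odd (((S i).filter fun k : Fin n => Nat.testBit p.1.val k).card +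
            ((T i).filter fun k : Fin n => Nat.testBit p.2.val k).card) then F p else 0)|
        ≤ ∑ i, |(w i : ℝ)| * (4 * δ) :=
          Finset.sum_le_sum fun i _ => mul_le_mul_of_nonneg_left (hgate i) (abs_nonneg _)
      _ = (W : ℝ) * (4 * δ) := by rw [← Finset.sum_mul, hWdef]; push_cast; rfl
      _ ≤ s * (n : ℝ) ^ c * (4 * δ) := mul_le_mul_of_nonneg_right hWle (by positivity)
  have hthr : |2 * (w₀' : ℝ) - 1| ≤ 2 * (s * (n : ℝ) ^ c) + 3 := by
    have h1 : |(w₀' : ℝ)| ≤ W + 1 := by exact_mod_cast hw₀'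
    calc |2 * (w₀' : ℝ) - 1| ≤ |2 * (w₀' : ℝ)| + |(1 : ℝ)| := abs_sub _ _
      _ = 2 * |(w₀' : ℝ)| + 1 := by rw [abs_mul]; norm_num
      _ ≤ 2 * (s * (n : ℝ) ^ c) + 3 := by linarith
  have hT2 : |2 * (w₀' : ℝ) - 1| * |∑ p : Fin (2 ^ n) × Fin (2 ^ n), F p| ≤
      (2 * (s * (n : ℝ) ^ c) + 3) * (4 * δ) :=
    mul_le_mul hthr hconst (abs_nonneg _) (by positivity)
  have hs' : (s : ℝ) ≤ (n : ℝ) ^ c := by exact_mod_cast hs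
  have hn29' : (29 : ℝ) ≤ n := by exact_mod_cast hn29
  -- `4^n ≤ (16 n^{2c} + 12) δ`
  have hmain : (4 : ℝ) ^ n ≤ (16 * (n : ℝ) ^ (2 * c) + 12) * δ := by
    have h2c : (n : ℝ) ^ c * (n : ℝ) ^ c = (n : ℝ) ^ (2 * c) := by rw [← pow_add]; ring_nf
    rw [hcard] at hD
    have hsn : (s : ℝ) * (n : ℝ) ^ c * δ ≤ (n : ℝ) ^ (2 * c) * δ := by
      rw [← h2c]
      exact mul_le_mul_of_nonneg_right (mul_le_mul_of_nonneg_right hs' (by positivity)) hδ0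
    linarith
  -- `(16 n^{2c} + 12) δ < 4^n` for `n ≥ 29`
  have hlt : (16 * (n : ℝ) ^ (2 * c) + 12) * δ < (4 : ℝ) ^ n := by
    rw [hδdef, pow_succ, ← mul_div_assoc, div_lt_iff₀ (by positivity)]
    have h4 : (0 : ℝ) < (4 : ℝ) ^ n := by positivity
    have hpos : (0 : ℝ) < (n : ℝ) ^ (2 * c) * n - (16 * (n : ℝ) ^ (2 * c) + 12) := by
      have hX1 : (1 : ℝ) ≤ (n : ℝ) ^ (2 * c) := one_le_pow₀ (by linarith)
      nlinarith [mul_le_mul_of_nonneg_left hn29' (by positivity : (0 : ℝ) ≤ (n : ℝ) ^ (2 * c))]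
    nlinarith [mul_pos h4 hpos]
  exact absurd (hmain.trans_lt hlt) (lt_irrefl _)

end Summit.QuantumAdvantage.QuantumAdvantage.Theorems.HankelLift
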